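import Literature.MathematicalPhysics.QuantumFieldTheory.Balaban1983to89.B9Ineq349
import Literature.MathematicalPhysics.QuantumFieldTheory.Balaban1983to89.B9SectBStepWhole

/-!
# `Balaban1983to89.B9Ineq349Whole` — [B9] (3.49) p. 399 AS THE WHOLE PRINTED LEAF `B9.Stmt349Printed`: a glue module over
# the landed one-configuration theorem `B9Ineq349.ineq349_of_thms31to33`, Theorems 3.1 and 3.2 as typed, Lemma 2.1 of [4]
# in generic-constant shape, the model signs, and the (3.25)-in-kernels dictionary

T. Bałaban, *Propagators for lattice gauge theories in a background field*, Commun. Math. Phys. **99** (1985) 389–434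
[`Balaban1985BackgroundPropagators`, "B9"]; [4] = T. Bałaban, *Propagators and renormalization transformations for lattice
gauge theories. II*, Commun. Math. Phys. **96** (1984) 223–250 [`Balaban1984PropagatorsII`].

statement-level skeleton of published theorems with citation tags; proofs where landed; nothing here is a claim about the
Yang–Mills mass gap

THE PRINTED LOCUS (verbatim, p. 399 [PDF 11]).  *"These theorems imply all the properties of the operator R, or DRD\*, we
will need in the future. For the operator P = I − R we obtain, using again Lemma 2.1, \[|P(x, x′)|, |(DP)_μ(x, x′)|,
|(PD\*)_ν(x, x′)|, |(DPD\*)_{μν}(x, x′)|\] ≦ O(1)\[1, (L^jη)^{−1}, (L^jη)^{−1}, (L^jη)^{−2}\](L^{j′}η)^{−d}e^{−(1/2)δ₀d(y,y′)} for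
x ∈ Δ(y), y ∈ Λ_j, x′ ∈ Δ(y′), y′ ∈ Λ_{j′}. (3.49)"* — "these theorems" = Theorems 3.1, 3.2 ((3.42), (3.48) pp. 397–398),
"Lemma 2.1" = [4] Lemma 2.1 (2.60)–(2.63) p. 234, P = G′Q′\*(Q′G′²Q′\*)^{−1}Q′G′ by (3.25) p. 394.

THE POINT.  The cell's typed skeleton `…Balaban1983to89.B9` carries (3.49) as the family leaf `B9.Stmt349Printed d c35 geo bg P`
("under Theorem-3.1-type thresholds, `B9.Ineq349 d (P i) C δ₀ U` with one O(1)"; GAPS G-B9-12 «asserted-routine»), consumed by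
`DagBinding.B9LeafX` ∕ `B9LeafKnit.b9LeafX_of_leaves` as the hypothesis `s349`.  The lineage `…B9Ineq349` (unit pv16) PROVES
(3.49) AT ONE CONFIGURATION from the block `B9.Thms31to33IneqAt` at U, Lemma 2.1 in its (2.60)∕(2.61) shapes and the
kernel dictionaries (`B9Ineq349.ineq349_of_thms31to33`, O(1) = B₀²B₁L⁴L^dL²c³ explicit, rate ½δ₀ via `rates_349`), but no
theorem concluded the family leaf (N06 ASSIGNMENT row 25, «free»).  THIS FILE is that glue:

* §1 the inputs as schemas — `Dict349 Gp Cinv P` (at every U: the (3.49)-entries of P are dominated by the three-factor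
  composition (3.25) whose outer kernels are observed by the entries of (3.42) — `B9Ineq349.CompDominated` + `ObservedBy`,
  cell GAPS G-pv16-1, located, not displayed in print); `DistOK g` (1 ≦ L, 0 < η, d symmetric with the triangle inequality
  (2.54) — the facts of the multiscale distance of [4] (2.46) the abstract carrier cannot see); `LevelGap geo R` ([4] (2.60)
  in its GEOMETRIC form d(y, y′) ≧ RM·max(|j − j′| − 1, 0), rate-free); `RowSum261 geo` ([4] (2.61) with a GENERIC
  constant at EVERY rate under an M-threshold — *"RM sufficiently large"* (2.59); NOT the printed c₁(α), which the tree
  refutes as typed for d ≧ 3, `B6Lemma21Counterexample.printed_c1_exceeded`).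
* §2 `ineq349_of_blocks` — ONE member, ONE U, TWO INPUT RATES: from (3.42)–(3.45) for G′ at U with (B₀, δ₀) and (3.48) at U
  with (B₁, δ₁) (B₀, B₁ ≧ 0), the model signs (`B9FromB6ModelSignsOn.ModelSignsOn`, on ANY sub-family of arguments — the
  sign schema of record at pub-ymgap's pin, dag-n06-d INTERFACE-1), `DistOK`, the level gap with R > 0, the (2.61) row sums at
  the rate ¼δ = ⅙min(δ₀, δ₁) (δ = ⅔·min(δ₀, δ₁)) and the largeness L⁴, L^d ≦ e^{¼δRM}, and the dictionary at U: `B9.Ineq349 d P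
  (B₀B₁B₀·L⁴L^dL²·c³) (min δ₀ δ₁) U` — i.e. the printed rate ½δ₀ when δ₁ = δ₀ ("with the same constants", Thm 3.2).  Proof:
  weaken both blocks to the common rate min(δ₀, δ₁) (`B9SectBStepWhole.ineq342_346_347_mono` ∕ `ineq343_345_mono` ∕
  `kerBound_mono`), fill the G-slot of `B9.Thms31to33IneqAt` with the G′-block (the composition (3.25) reads G′ and
  (Q′G′²Q′\*)^{−1} only), and apply `B9Ineq349.ineq349_of_thms31to33` BY NAME with α = ¼ (`rates_349`).
* §3 ★ `stmt349Printed_of_thm31_thm32` — **THE WHOLE PRINTED LEAF** `B9.Stmt349Printed d c35 geo bg P` from `B9.Thm31Printed c35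
  geo bg Gp` and `B9.Thm32Printed d c35 geo bg Cinv` (the typed Theorems 3.1, 3.2 — in the N06 knit these are DERIVED,
  `B9.thm31_of_thm37` ∕ `B9.thm32_of_thm39`), the model signs, `DistOK`, a COMMON L across the family (p. 399: constants
  depend on d, L only), `LevelGap`, `RowSum261` and `Dict349` per member.  The printed quantifiers are met with
  M₁′ := max(M₁, M₂, M_L(κ), (L⁴ + L^d)∕(κR)), κ = ⅙min(δ₀, δ₁), and a₀′ := min(a₀, a₂); O(1) := B₀²B₁L⁴L^dL²·max(c, 1)³.

HONEST SCOPE.  Nothing of print is asserted: Theorems 3.1∕3.2, Lemma 2.1's shapes, the dictionary and the sign facts are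
HYPOTHESES (each named; the dictionary is the unprinted kernel form of (3.25), G-pv16-1); the Hölder sentence after (3.49)
and *"Thus the operator Δ_a is well defined"* are not typed (as in the lineage).  Value: kernel-checked bookkeeping — the
family leaf inhabited over the lineage's one-configuration theorem with explicit thresholds and O(1) — NOT a node discharge,
NOT summit progress; one finite lattice programme; nothing continuum, nothing about the mass gap.  Cell `pub-ymgap` (HUMAN
RULING D-0062), Track A node N06 [B9], N06-ASSIGNMENT v1 row 25 (bundle F4), seat `pub-ymgap-dag-n06-i`, 2026-08-26.
-/

namespace Literature.MathematicalPhysics.QuantumFieldTheory.Balaban1983to89.B9Ineq349Whole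

open Literature.MathematicalPhysics.QuantumFieldTheory.Balaban1983to89
open B9Ineq349 B9FromB6ModelSignsOn B9SectBStepWhole

noncomputable section

/-! ## §1 The inputs as schemas -/

section OneMember

variable {g : B9.Geometry} {B : B9.Backgrounds}

/-- **THE (3.25)-IN-KERNELS DICTIONARY AT EVERY CONFIGURATION** (hypothesis shape, not printed; cell GAPS G-pv16-1, located):
by (3.25) p. 394, P = I − R = G′Q′\*(Q′G′²Q′\*)^{−1}Q′G′, so at every U the four (3.49)-quantities of P (`P.ker n U y y′` = the sup
over x ∈ Δ(y), x′ ∈ Δ(y′) of |(D^aPD\*^b)(x, x′)|) are dominated by the plain double sum over 𝔅 × 𝔅 of a left sup-kernel `K₁ n`,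
the absolute kernel of (Q′G′²Q′\*)^{−1} and a right sup-kernel `K₃ n` (`B9Ineq349.CompDominated`), the outer kernels being
OBSERVED BY the entries `entL n`, `entR n` of (3.42) on test functions of sup norm ≦ 1 localised in one block
(`B9Ineq349.ObservedBy`). [cite: Balaban1985BackgroundPropagators, (3.25) p.394 with (3.42) p.397 and (3.48)–(3.49) pp.398–399] -/
def Dict349 [Fintype g.Site] (Gp : B9.KernelFamily g B) (Cinv : B9.SiteKernel g B) (P : B9.FineKernel g B) : Prop :=
  ∀ U : B.Cfg, ∃ K₁ K₃ : Fin 4 → g.Site → g.Site → ℝ,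
    CompDominated Cinv P U K₁ K₃ ∧ (∀ n : Fin 4, ObservedBy Gp U (entL n) (K₁ n)) ∧
      (∀ n : Fin 4, ObservedBy Gp U (entR n) (fun y' y₂ => K₃ n y₂ y'))

/-- **THE FACTS OF THE MULTISCALE DISTANCE THE ABSTRACT CARRIER CANNOT SEE**: 1 ≦ L and 0 < η (so L^jη > 0), and the distance
d(y, y′) of [4] (2.46) is symmetric and obeys the triangle inequality (2.54) p. 233 (d ≧ 0 is a field of the model-signs schema
`B9FromB6ModelSignsOn.ModelSignsOn`).  Hypothesis schema over `B9.Geometry`. [cite: Balaban1984PropagatorsII, (2.46) p.231 + (2.54) p.233] -/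
structure DistOK (g : B9.Geometry) : Prop where
  one_le_L : 1 ≤ g.L
  eta_pos : 0 < g.eta
  symm : ∀ y y' : g.Site, g.dist y y' = g.dist y' y
  tri : ∀ a b c : g.Site, g.dist a c ≤ g.dist a b + g.dist b c

end OneMember

section FamilySchemas

variable {I : Type}

/-- **[4] (2.60) IN ITS GEOMETRIC FORM over the family**: d(y, y′) ≧ R·M·max(|j − j′| − 1, 0) for y ∈ Λ_j, y′ ∈ Λ_{j′} (p. 234:
*"e^{−αδ₀d(y,y′)} ≤ e^{−αδ₀RM max{|j−j′|−1,0}} (2.60)"* is this inequality at every rate αδ₀ > 0), with the parameter R of (2.1)–(2.2).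
Hypothesis schema (the tree derives the exponential form on realised geometries, `B6Geometry.ineq260_of_levelGap`).
[cite: Balaban1984PropagatorsII, Lemma 2.1 (2.60) p.234] -/
def LevelGap (geo : I → B9.Geometry) (R : ℝ) : Prop :=
  ∀ (i : I) (y y' : (geo i).Site),
    R * (geo i).M * max (|((geo i).scale y : ℝ) - ((geo i).scale y' : ℝ)| - 1) 0 ≤ (geo i).dist y y'

/-- **[4] (2.61) WITH A GENERIC CONSTANT, AT EVERY RATE, UNDER AN M-THRESHOLD**: for every κ > 0 there are M_L and c such that
every member with M ≧ M_L has all row sums Σ_{y′∈𝔅} e^{−κd(y,y′)} ≦ c (p. 234: *"sup_{y∈𝔅} Σ_{y′∈𝔅} e^{−αδ₀d(y,y′)} ≤ c₁(α), (2.61)"*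
for *"RM satisfying (2.59)"*).  The constant is GENERIC on purpose: the printed c₁(α) = 12c₀^d(½α) is refuted as typed for
d ≧ 3 (`B6Lemma21Counterexample.printed_c1_exceeded`); every consumer uses (2.61) only as an α-dependent O(1).  Hypothesis
schema. [cite: Balaban1984PropagatorsII, Lemma 2.1 (2.61) p.234 + (2.59) p.233] -/
def RowSum261 (geo : I → B9.Geometry) [∀ i, Fintype (geo i).Site] : Prop :=
  ∀ κ : ℝ, 0 < κ → ∃ ML c : ℝ, ∀ i : I, ML ≤ (geo i).M →
    ∀ y : (geo i).Site, ∑ y' : (geo i).Site, Real.exp (-(κ * (geo i).dist y y')) ≤ c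

end FamilySchemas

/-! ## §2 (3.49) at one member and one configuration, from the two blocks with their own rates -/

section OneU

variable {g : B9.Geometry} {B : B9.Backgrounds} [Fintype g.Site]

/-- **(3.49) AT ONE CONFIGURATION FROM (3.42)–(3.45) FOR G′ AND (3.48), WITH TWO INPUT RATES** — p. 399 *"These theorems imply …
For the operator P = I − R we obtain, using again Lemma 2.1, … (3.49)"*.  Inputs at U: Theorem 3.1's blocks for G′ with (B₀, δ₀)
and (B₀(·), B′₀(·), B′₀(·,·)), Theorem 3.2's bound (3.48) with (B₁, δ₁) (B₀, B₁ ≧ 0, δ₀, δ₁ > 0); the model signs on any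
sub-family of arguments, `DistOK`; Lemma 2.1 of [4] at this member as the level gap with parameter R, the (2.61) row sums ≦ c at the
rate ¼δ = ⅙min(δ₀, δ₁) (δ := ⅔·min(δ₀, δ₁)), and the largeness L⁴, L^d ≦ e^{⅙min(δ₀,δ₁)RM} of the M-threshold; the dictionary at U.  Conclusion: the
tree's leaf `B9.Ineq349 d P (B₀B₁B₀·L⁴L^dL²·c³) (min δ₀ δ₁) U` — rate ½min(δ₀, δ₁) in the display (= ½δ₀ for print's δ₁ = δ₀).
Proof = weaken both blocks to the common rate (`B9SectBStepWhole.*_mono`), put the G′-block in both kernel slots of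
`B9.Thms31to33IneqAt` (the G-slot is not read by (3.49)), and `B9Ineq349.ineq349_of_thms31to33` with α = ¼ (`rates_349`).
[cite: Balaban1985BackgroundPropagators, (3.49) p.399; Balaban1984PropagatorsII, Lemma 2.1 (2.60)–(2.61) p.234] -/
theorem ineq349_of_blocks (d : ℕ) {Gp : B9.KernelFamily g B} {Cinv : B9.SiteKernel g B} {P : B9.FineKernel g B}
    {Q : g.Loc → Prop} (S : ModelSignsOn g Q) (D : DistOK g) {B₀ δ₀ B₁ δ₁ : ℝ} {Bβ Bε : ℝ → ℝ} {Bεβ : ℝ → ℝ → ℝ}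
    {U : B.Cfg} (hB₀ : 0 ≤ B₀) (hδ₀ : 0 < δ₀) (hB₁ : 0 ≤ B₁) (hδ₁ : 0 < δ₁)
    (h342 : B9.Ineq342_346_347 Gp B₀ δ₀ U) (h343 : B9.Ineq343_345 Gp Bβ Bε Bεβ δ₀ U)
    (h348 : ∀ y y' : g.Site, |Cinv.ker U y y'| ≤
      B₁ * (g.len y) ^ (-(4 : ℝ)) * (g.len y') ^ (-(d : ℝ)) * Real.exp (-(δ₁ * g.dist y y')))
    {R c : ℝ}
    (hgap : ∀ y y' : g.Site, R * g.M * max (|(g.scale y : ℝ) - (g.scale y' : ℝ)| - 1) 0 ≤ g.dist y y')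
    (h261 : ∀ y : g.Site, ∑ y' : g.Site, Real.exp (-(min δ₀ δ₁ / 6 * g.dist y y')) ≤ c)
    (hl4 : g.L ^ (4 : ℝ) ≤ Real.exp (min δ₀ δ₁ / 6 * R * g.M))
    (hld : g.L ^ (d : ℝ) ≤ Real.exp (min δ₀ δ₁ / 6 * R * g.M))
    {K₁ K₃ : Fin 4 → g.Site → g.Site → ℝ} (hP : CompDominated Cinv P U K₁ K₃)
    (hK₁ : ∀ n : Fin 4, ObservedBy Gp U (entL n) (K₁ n))
    (hK₃ : ∀ n : Fin 4, ObservedBy Gp U (entR n) (fun y' y₂ => K₃ n y₂ y')) :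
    B9.Ineq349 d P (B₀ * B₁ * B₀ * g.L ^ (4 : ℝ) * g.L ^ (d : ℝ) * g.L ^ (2 : ℝ) * c ^ 3) (min δ₀ δ₁) U := by
  -- the common rate δ′ = min(δ₀, δ₁) and the Lemma-2.1 rate δ = δ′ ∕ (2(1 − α)), α = ¼
  set δ' : ℝ := min δ₀ δ₁ with hδ'
  have hδ'0 : 0 ≤ δ' := le_min hδ₀.le hδ₁.le
  obtain ⟨hθ, ha, hb, hδ⟩ := rates_349 δ' (1 / 4) hδ'0 (by norm_num) le_rfl
  -- weaken both blocks to the common rate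
  have h342' : B9.Ineq342_346_347 Gp B₀ δ' U := ineq342_346_347_mono S h342 le_rfl hB₀ (min_le_left _ _)
  have h343' : B9.Ineq343_345 Gp (fun β => max (Bβ β) 0) (fun ε => max (Bε ε) 0) (fun ε β => max (Bεβ ε β) 0) δ' U :=
    ineq343_345_mono S h343 (fun _ => le_max_left _ _) (fun _ => le_max_right _ _) (fun _ => le_max_left _ _)
      (fun _ => le_max_right _ _) (fun _ _ => le_max_left _ _) (fun _ _ => le_max_right _ _) (min_le_left _ _)
  have h348' := kerBound_mono S d h348 le_rfl hB₁ (min_le_right δ₀ δ₁)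
  have hT : B9.Thms31to33IneqAt d Gp Gp Cinv B₀ δ' (fun β => max (Bβ β) 0) (fun ε => max (Bε ε) 0)
      (fun ε β => max (Bεβ ε β) 0) B₁ δ' U :=
    ⟨⟨h342', h343'⟩, h348', ⟨h342', h343'⟩⟩
  -- the rate αδ = δ′∕6; (2.60) in exponential form at this rate from the level gap
  have hr : 1 / 4 * (δ' / (2 * (1 - 1 / 4))) = δ' / 6 := by ring
  have hαδ : 0 ≤ 1 / 4 * (δ' / (2 * (1 - 1 / 4))) := mul_nonneg (by norm_num) hδ
  have h260 : ∀ y y' : g.Site, Real.exp (-(1 / 4 * (δ' / (2 * (1 - 1 / 4))) * g.dist y y')) ≤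
      Real.exp (-(1 / 4 * (δ' / (2 * (1 - 1 / 4))) * R * g.M * max (|(g.scale y : ℝ) - (g.scale y' : ℝ)| - 1) 0)) := by
    intro y y'
    apply Real.exp_le_exp.mpr
    have h1 := mul_le_mul_of_nonneg_left (hgap y y') hαδ
    have e : 1 / 4 * (δ' / (2 * (1 - 1 / 4))) * R * g.M * max (|(g.scale y : ℝ) - (g.scale y' : ℝ)| - 1) 0 =
        1 / 4 * (δ' / (2 * (1 - 1 / 4))) * (R * g.M * max (|(g.scale y : ℝ) - (g.scale y' : ℝ)| - 1) 0) := by ring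
    rw [e]
    exact neg_le_neg h1
  exact ineq349_of_thms31to33 d Gp Gp Cinv P B₀ δ' _ _ _ B₁ δ' U hT D.one_le_L D.eta_pos S.dist_nonneg D.symm D.tri
    hB₀ hB₁ R (1 / 4) (δ' / (2 * (1 - 1 / 4))) c (by norm_num) (by norm_num) hδ h260 (fun y => by rw [hr]; exact h261 y)
    (by rw [hr]; exact hl4) (by rw [hr]; exact hld) ha hb hθ.symm.le K₁ K₃ hP hK₁ hK₃

end OneU

/-! ## §3 The whole printed leaf -/

section Family

variable {I : Type} {c35 : ℝ} {geo : I → B9.Geometry} {bg : I → B9.Backgrounds} [∀ i, Fintype (geo i).Site]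

omit [∀ i, Fintype (geo i).Site] in
/-- Arithmetic of «RM sufficiently large» (2.59): for 1 ≦ L, κ > 0 and M ≧ (L⁴ + L^d)∕κ, both L⁴ and L^d are ≦ e^{κM}
(e^x ≧ 1 + x). [cite: Balaban1984PropagatorsII, (2.59) p.233 (bookkeeping: the largeness used with (2.60))] -/
theorem pow_le_exp_of_threshold {L κ M : ℝ} (d : ℕ) (hL : 1 ≤ L) (hκ : 0 < κ)
    (hM : (L ^ (4 : ℝ) + L ^ (d : ℝ)) / κ ≤ M) :
    L ^ (4 : ℝ) ≤ Real.exp (κ * M) ∧ L ^ (d : ℝ) ≤ Real.exp (κ * M) := by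
  have hL0 : 0 ≤ L := le_trans zero_le_one hL
  have h4 : 0 ≤ L ^ (4 : ℝ) := Real.rpow_nonneg hL0 _
  have hd : 0 ≤ L ^ (d : ℝ) := Real.rpow_nonneg hL0 _
  have hsum : L ^ (4 : ℝ) + L ^ (d : ℝ) ≤ κ * M := by
    have h := (div_le_iff₀ hκ).mp hM
    linarith [h]
  have hexp : κ * M ≤ Real.exp (κ * M) := by linarith [Real.add_one_le_exp (κ * M)]
  exact ⟨by linarith, by linarith⟩

/-- ★ **(3.49) AS THE WHOLE PRINTED LEAF `B9.Stmt349Printed`** (p. 399: *"These theorems imply all the properties of the operator R,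
or DRD\*, we will need in the future. For the operator P = I − R we obtain, using again Lemma 2.1, … (3.49)"*), INHABITED from:
Theorem 3.1 as typed (`B9.Thm31Printed c35 geo bg Gp`) and Theorem 3.2 as typed (`B9.Thm32Printed d c35 geo bg Cinv`) — in the
N06 knit both are DERIVED (`B9.thm31_of_thm37`, `B9.thm32_of_thm39`); the model signs per member on any sub-family of arguments
(`ModelSignsOn`, the sign schema of record); `DistOK` per member and ONE L for the family (p. 399: the constants depend on d, L
only); Lemma 2.1 of [4] as `LevelGap geo R` (R > 0) and `RowSum261 geo`; the (3.25)-in-kernels dictionary `Dict349` per member.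
The printed quantifiers are met with M₁′ := max(max M₁ M₂, max M_L ((L⁴ + L^d)∕(κR))) (κ := ⅙min(δ₀, δ₁) = ¼δ, δ := ⅔·min(δ₀, δ₁), M_L from
`RowSum261` at the rate κ), a₀′ := min(a₀, a₂), the rate min(δ₀, δ₁) and O(1) := B₀B₁B₀·L⁴L^dL²·max(c, 1)³ — explicit.
Nothing of print asserted (all inputs are hypotheses of printed shape); NOT a node discharge.
[cite: Balaban1985BackgroundPropagators, (3.49) p.399 + Thm 3.1 (3.42) p.397 + Thm 3.2 (3.48) p.398; Balaban1984PropagatorsII, Lemma 2.1 (2.59)–(2.61) pp.233–234] -/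
theorem stmt349Printed_of_thm31_thm32 (d : ℕ) {Gp : ∀ i, B9.KernelFamily (geo i) (bg i)}
    {Cinv : ∀ i, B9.SiteKernel (geo i) (bg i)} {P : ∀ i, B9.FineKernel (geo i) (bg i)}
    (h31 : B9.Thm31Printed c35 geo bg Gp) (h32 : B9.Thm32Printed d c35 geo bg Cinv)
    {Q : ∀ i, (geo i).Loc → Prop} (S : ∀ i, ModelSignsOn (geo i) (Q i)) (D : ∀ i, DistOK (geo i))
    {L : ℝ} (hL : 1 ≤ L) (hLi : ∀ i, (geo i).L = L) {R : ℝ} (hR : 0 < R) (hgap : LevelGap geo R)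
    (h261 : RowSum261 geo)
    (hdict : ∀ i, Dict349 (Gp i) (Cinv i) (P i)) :
    B9.Stmt349Printed d c35 geo bg P := by
  obtain ⟨M₁, δ₀, a₀, B₀, Bβ, Bε, Bεβ, hM₁, hδ₀, ha₀, hB₀, H1⟩ := h31
  obtain ⟨M₂, δ₁, a₂, B₁, hM₂, hδ₁, ha₂, hB₁, H2⟩ := h32
  -- the rates
  set δ' : ℝ := min δ₀ δ₁ with hδ'
  have hδ'pos : 0 < δ' := lt_min hδ₀ hδ₁
  set κ : ℝ := δ' / 6 with hκ
  have hκpos : 0 < κ := by rw [hκ]; positivity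
  obtain ⟨ML, c, H61⟩ := h261 κ hκpos
  -- the generic (2.61) constant floored at 1, and the O(1)
  set c' : ℝ := max c 1 with hc'
  have hc'1 : 1 ≤ c' := le_max_right _ _
  have hκR : 0 < κ * R := mul_pos hκpos hR
  set Mbig : ℝ := (L ^ (4 : ℝ) + L ^ (d : ℝ)) / (κ * R) with hMbig
  refine ⟨max (max M₁ M₂) (max ML Mbig), δ', min a₀ a₂,
    B₀ * B₁ * B₀ * L ^ (4 : ℝ) * L ^ (d : ℝ) * L ^ (2 : ℝ) * c' ^ 3,
    lt_max_of_lt_left (lt_max_of_lt_left hM₁), hδ'pos, lt_min ha₀ ha₂, ?_, ?_⟩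
  · have hL0 : 0 < L := lt_of_lt_of_le one_pos hL
    have hc'0 : 0 < c' := lt_of_lt_of_le one_pos hc'1
    positivity
  · intro i hM α₀ hα₀ hMa U hU
    have hM₁i : M₁ ≤ (geo i).M := le_trans (le_trans (le_max_left _ _) (le_max_left _ _)) hM
    have hM₂i : M₂ ≤ (geo i).M := le_trans (le_trans (le_max_right _ _) (le_max_left _ _)) hM
    have hMLi : ML ≤ (geo i).M := le_trans (le_trans (le_max_left _ _) (le_max_right _ _)) hM
    have hMbi : Mbig ≤ (geo i).M := le_trans (le_trans (le_max_right _ _) (le_max_right _ _)) hM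
    obtain ⟨h342, h343⟩ := H1 i hM₁i α₀ hα₀ (le_trans hMa (min_le_left _ _)) U hU
    have h348 := H2 i hM₂i α₀ hα₀ (le_trans hMa (min_le_right _ _)) U hU
    obtain ⟨K₁, K₃, hP, hK₁, hK₃⟩ := hdict i U
    -- (2.61) at this member, floored constant
    have h61 : ∀ y : (geo i).Site, ∑ y' : (geo i).Site, Real.exp (-(κ * (geo i).dist y y')) ≤ c' :=
      fun y => (H61 i hMLi y).trans (le_max_left _ _)
    -- the largeness L⁴, L^d ≤ e^{κRM}
    have hL1 : 1 ≤ (geo i).L := (D i).one_le_L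
    have hMb' : ((geo i).L ^ (4 : ℝ) + (geo i).L ^ (d : ℝ)) / (κ * R) ≤ (geo i).M := by rw [hLi i]; exact hMbi
    obtain ⟨hl4, hld⟩ := pow_le_exp_of_threshold d hL1 hκR hMb'
    have h := ineq349_of_blocks d (S i) (D i) hB₀.le hδ₀ hB₁.le hδ₁ h342 h343 h348 (hgap i) h61 hl4 hld hP hK₁ hK₃
    rw [hLi i] at h
    exact h

end Family

end

end Literature.MathematicalPhysics.QuantumFieldTheory.Balaban1983to89.B9Ineq349Whole
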